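import Summits.CriticalPhenomena.CardyFormulaZ2.Theorems.CardyComplexConeEdgePrecompactUFRSMarkedDecayRectLocal

/-!
# UFRS, decay at the marked points (rectangles), part 4: guarded events, independence, the five factors
(line `qkz-strip-boundary-arm` of crux `CardyComplexCone.EdgePrecompact`, stmt-CriticalPhenomena-11387;
support for the registered sub-goal `ufrs_markedPointDecay_rect`, wave 3 of lead c4)

The per-box event of the MARKED branch of the UFRS certificate is a guarded five-fold intersection:
two FLAT events (three strand-crossings around the box centre `q` at the inner scales) and three
JUNCTION events (two strand-crossings around the nearest marked edge `m` at the inner, middle and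
outer scales). This file provides the bookkeeping:

* guarded events `{ω | g → ω ∈ A}` (`setOf_imp_of_pos/neg_W3M`, `determinedBy_imp_W3M`,
  `measurableSet_imp_W3M`, `real_imp_le_W3M`);
* `real_inter5_W3M` — five events read off pairwise disjoint edge sets are independent under
  `P_{1/2}` (iterated `bondPercolation_real_inter_of_disjoint`), and `disjoint_annulusEdges_W3M` —
  edge annuli `[lo, hi]` around two centres are disjoint when `hi₁ + dist c₁ c₂ < lo₂`;
* ratio powers (`rpow_ratio_le_W3M`, `one_le_rpow_ratio_W3M`, `rpow_ratio_mul_W3M` (registered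
  anchor), `rpow_mul_rpow_le_W3M`);
* the FIVE FACTOR BOUNDS `flat₁_le_W3M`, `flat₂_le_W3M`, `junc₁_le_W3M`, `junc₂_le_W3M`,
  `junc₃_le_W3M`: given the flat three-strand decay `C_T (s/S)^{1+α}` at `q` (resp. the junction
  two-strand decay `C_J (s/S)^β` at `m`), each guarded factor is bounded by a clean ratio power —
  `C_T' (32η/D₂)^{1+α}`, `C_T' (16 D₂/U)^{1+α}`, `C_J' (64U/D₁)^β`, `C_J' (64D₁/R₁)^β`,
  `C_J' (64R₁/ρ₁)^β` with `D₂ = min (max d 32η) (U/16)`, `D₁ = max d 64U`, `R₁ = max R' 64U`,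
  `ρ₁ = max ρ 64U` — valid whether or not the guard holds, so that the product telescopes to
  `(η/U)^{1+α} (U/ρ)^β` without case analysis.

References: G. F. Lawler, O. Schramm, W. Werner, Electron. J. Probab. 7 (2002), Appendix A;
G. Grimmett, Percolation (1999), §2.2 (product measure, cylinder events).
-/

namespace Summit.CriticalPhenomena.CardyFormulaZ2.Cruxes.EdgePrecompact.QkzStripBoundaryArm

open MeasureTheory Filter Set Metric
open scoped Topology BigOperators Pointwise
open Literature.Probability.LatticeModels Literature.Probability.Percolation
open Literature.Probability.RandomPlanarGeometry (DobrushinDomain)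
open Summit.CriticalPhenomena.CardyFormulaZ2.Theses.CardyComplexCone

noncomputable section

/-! ## Part 4: helpers — guarded events, five-fold independence, ratio powers -/

/-- A guarded event whose guard holds is the event. -/
theorem setOf_imp_of_pos_W3M {g : Prop} (hg : g) (A : Set (BondConfig (Site 2))) :
    {ω : BondConfig (Site 2) | g → ω ∈ A} = A := by
  ext ω; simp [hg]

/-- A guarded event whose guard fails is the sure event. -/
theorem setOf_imp_of_neg_W3M {g : Prop} (hg : ¬ g) (A : Set (BondConfig (Site 2))) :
    {ω : BondConfig (Site 2) | g → ω ∈ A} = Set.univ := by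
  ext ω; simp [hg]

/-- A guarded event is determined by whatever determines the event. -/
theorem determinedBy_imp_W3M {g : Prop} {A : Set (BondConfig (Site 2))} {S : Set (Sym2 (Site 2))}
    (h : DeterminedBy A S) : DeterminedBy {ω : BondConfig (Site 2) | g → ω ∈ A} S := by
  by_cases hg : g
  · rw [setOf_imp_of_pos_W3M hg]; exact h
  · rw [setOf_imp_of_neg_W3M hg]; exact determinedBy_univ S

/-- A guarded measurable event is measurable. -/
theorem measurableSet_imp_W3M {g : Prop} {A : Set (BondConfig (Site 2))} (h : MeasurableSet A) :
    MeasurableSet {ω : BondConfig (Site 2) | g → ω ∈ A} := by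
  by_cases hg : g
  · rw [setOf_imp_of_pos_W3M hg]; exact h
  · rw [setOf_imp_of_neg_W3M hg]; exact MeasurableSet.univ

/-- Bounding the probability of a guarded event: by the bound of the event if the guard holds,
by `1` otherwise. -/
theorem real_imp_le_W3M {g : Prop} {A : Set (BondConfig (Site 2))} {b : ℝ}
    (h₁ : g → (bondPercolation (zdGraph 2) half).real A ≤ b) (h₂ : ¬ g → 1 ≤ b) :
    (bondPercolation (zdGraph 2) half).real {ω : BondConfig (Site 2) | g → ω ∈ A} ≤ b := by
  by_cases hg : g
  · rw [setOf_imp_of_pos_W3M hg]; exact h₁ hg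
  · rw [setOf_imp_of_neg_W3M hg, probReal_univ]; exact h₂ hg

/-- **Independence of five events read off pairwise disjoint edge sets** (iterated
`bondPercolation_real_inter_of_disjoint`). -/
theorem real_inter5_W3M {A₁ A₂ A₃ A₄ A₅ : Set (BondConfig (Site 2))} {T₁ T₂ T₃ T₄ T₅ : Set (Sym2 (Site 2))}
    (d₁ : DeterminedBy A₁ T₁) (d₂ : DeterminedBy A₂ T₂) (d₃ : DeterminedBy A₃ T₃) (d₄ : DeterminedBy A₄ T₄)
    (d₅ : DeterminedBy A₅ T₅) (m₁ : MeasurableSet A₁) (m₂ : MeasurableSet A₂) (m₃ : MeasurableSet A₃)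
    (m₄ : MeasurableSet A₄) (m₅ : MeasurableSet A₅)
    (h₁₂ : Disjoint T₁ T₂) (h₁₃ : Disjoint T₁ T₃) (h₁₄ : Disjoint T₁ T₄) (h₁₅ : Disjoint T₁ T₅)
    (h₂₃ : Disjoint T₂ T₃) (h₂₄ : Disjoint T₂ T₄) (h₂₅ : Disjoint T₂ T₅) (h₃₄ : Disjoint T₃ T₄)
    (h₃₅ : Disjoint T₃ T₅) (h₄₅ : Disjoint T₄ T₅) :
    (bondPercolation (zdGraph 2) half).real (A₁ ∩ A₂ ∩ A₃ ∩ A₄ ∩ A₅) =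
      (bondPercolation (zdGraph 2) half).real A₁ * (bondPercolation (zdGraph 2) half).real A₂ *
        (bondPercolation (zdGraph 2) half).real A₃ * (bondPercolation (zdGraph 2) half).real A₄ *
          (bondPercolation (zdGraph 2) half).real A₅ := by
  have d₁₂ : DeterminedBy (A₁ ∩ A₂) (T₁ ∪ T₂) :=
    (d₁.mono Set.subset_union_left).inter (d₂.mono Set.subset_union_right)
  have d₁₂₃ : DeterminedBy (A₁ ∩ A₂ ∩ A₃) (T₁ ∪ T₂ ∪ T₃) :=
    (d₁₂.mono Set.subset_union_left).inter (d₃.mono Set.subset_union_right)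
  have d₁₂₃₄ : DeterminedBy (A₁ ∩ A₂ ∩ A₃ ∩ A₄) (T₁ ∪ T₂ ∪ T₃ ∪ T₄) :=
    (d₁₂₃.mono Set.subset_union_left).inter (d₄.mono Set.subset_union_right)
  rw [bondPercolation_real_inter_of_disjoint (zdGraph 2) half _ d₁₂₃₄ d₅ ((m₁.inter m₂).inter m₃ |>.inter m₄) m₅,
    bondPercolation_real_inter_of_disjoint (zdGraph 2) half _ d₁₂₃ d₄ ((m₁.inter m₂).inter m₃) m₄,
    bondPercolation_real_inter_of_disjoint (zdGraph 2) half _ d₁₂ d₃ (m₁.inter m₂) m₃,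
    bondPercolation_real_inter_of_disjoint (zdGraph 2) half h₁₂ d₁ d₂ m₁ m₂]
  · exact Set.disjoint_union_left.2 ⟨h₁₃, h₂₃⟩
  · exact Set.disjoint_union_left.2 ⟨Set.disjoint_union_left.2 ⟨h₁₄, h₂₄⟩, h₃₄⟩
  · exact Set.disjoint_union_left.2 ⟨Set.disjoint_union_left.2 ⟨Set.disjoint_union_left.2 ⟨h₁₅, h₂₅⟩, h₃₅⟩, h₄₅⟩

/-- **Disjoint edge annuli.** The edges both of whose endpoints lie in the annulus
`lo₁ ≤ |· - c₁| ≤ hi₁` and those for the annulus `lo₂ ≤ |· - c₂| ≤ hi₂` are disjoint as soon as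
`hi₁ + dist c₁ c₂ < lo₂`. -/
theorem disjoint_annulusEdges_W3M (δ : ℝ) {c₁ c₂ : ℂ} {lo₁ hi₁ lo₂ hi₂ : ℝ} (h : hi₁ + dist c₁ c₂ < lo₂) :
    Disjoint {e : Sym2 (Site 2) | ∀ x ∈ e, lo₁ ≤ dist (meshPoint δ x) c₁ ∧ dist (meshPoint δ x) c₁ ≤ hi₁}
      {e : Sym2 (Site 2) | ∀ x ∈ e, lo₂ ≤ dist (meshPoint δ x) c₂ ∧ dist (meshPoint δ x) c₂ ≤ hi₂} := by
  refine disjoint_edgeBands_W3M fun x hx hy => ?_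
  have := dist_triangle (meshPoint δ x) c₁ c₂
  linarith [hx.2, hy.1]

/-- The same, with the roles of the two annuli exchanged (`hi₂ + dist c₁ c₂ < lo₁`). -/
theorem disjoint_annulusEdges'_W3M (δ : ℝ) {c₁ c₂ : ℂ} {lo₁ hi₁ lo₂ hi₂ : ℝ} (h : hi₂ + dist c₁ c₂ < lo₁) :
    Disjoint {e : Sym2 (Site 2) | ∀ x ∈ e, lo₁ ≤ dist (meshPoint δ x) c₁ ∧ dist (meshPoint δ x) c₁ ≤ hi₁}
      {e : Sym2 (Site 2) | ∀ x ∈ e, lo₂ ≤ dist (meshPoint δ x) c₂ ∧ dist (meshPoint δ x) c₂ ≤ hi₂} := by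
  rw [dist_comm] at h
  exact (disjoint_annulusEdges_W3M δ h).symm

/-- Monotonicity of ratio powers: `(a/b)^p ≤ (a'/b')^p` when `a b' ≤ a' b` (positive
denominators, `0 ≤ a`, `0 ≤ p`). -/
theorem rpow_ratio_le_W3M {a b a' b' p : ℝ} (ha : 0 ≤ a) (hb : 0 < b) (hb' : 0 < b') (h : a * b' ≤ a' * b)
    (hp : 0 ≤ p) : (a / b) ^ p ≤ (a' / b') ^ p := by
  refine Real.rpow_le_rpow (div_nonneg ha hb.le) ?_ hp
  rw [div_le_div_iff₀ hb hb']
  exact h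

/-- A ratio power with numerator at least the (positive) denominator is at least `1`. -/
theorem one_le_rpow_ratio_W3M {a b p : ℝ} (hb : 0 < b) (h : b ≤ a) (hp : 0 ≤ p) : 1 ≤ (a / b) ^ p :=
  Real.one_le_rpow ((one_le_div hb).2 h) hp

/-- Telescoping of ratio powers: `(a/b)^p (b/c)^p = (a/c)^p` (`0 ≤ a`, `0 < b`, `0 < c`). -/
theorem rpow_ratio_mul_W3M : ∀ {a b c p : ℝ}, 0 ≤ a → 0 < b → 0 < c → (a / b) ^ p * (b / c) ^ p = (a / c) ^ p := by
  intro a b c p ha hb hc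
  rw [← Real.mul_rpow (div_nonneg ha hb.le) (div_nonneg hb.le hc.le)]
  congr 1
  field_simp

/-- Two small ratios to two positive powers are at most their product to the smaller power:
`x^α y^β ≤ (x y)^{min α β}` for `x, y ∈ [0, 1]`, `0 < α`, `0 < β`. -/
theorem rpow_mul_rpow_le_W3M {x y α β : ℝ} (hx : 0 ≤ x) (hx1 : x ≤ 1) (hy : 0 ≤ y) (hy1 : y ≤ 1)
    (hα : 0 < α) (hβ : 0 < β) : x ^ α * y ^ β ≤ (x * y) ^ min α β := by
  rw [Real.mul_rpow hx hy]
  refine mul_le_mul ?_ ?_ (Real.rpow_nonneg hy _) (Real.rpow_nonneg hx _)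
  · exact Real.rpow_le_rpow_of_exponent_ge' hx hx1 (le_min hα.le hβ.le) (min_le_left _ _)
  · exact Real.rpow_le_rpow_of_exponent_ge' hy hy1 (le_min hα.le hβ.le) (min_le_right _ _)

/-! ## Part 5: the per-box bound of the MARKED branch — the five factors -/

/-- **Flat factor, inner scale.** The guarded event "three strand-crossings of
`A(q; 7η, min(d/2, U/4) - 3η)`" (guard `64η ≤ U ∧ 32η ≤ d`) has probability at most
`C_T' (32 η / D₂)^{1+α}`, `D₂ = min (max d 32η) (U/16)`, `C_T' = max C_T 1`, given the flat
three-strand decay at `q` (hypothesis `hT`) and the separation of `q` from the marked edges. -/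
theorem flat₁_le_W3M {D : DobrushinDomain} {E : DiscreteDobrushin} {w : Site 2} {η U d CT α : ℝ} {q : ℂ}
    (hT : ∀ (z : ℂ) (s S : ℝ), z ∈ D.carrier → infDist z D.carrierᶜ ≤ s → η ≤ s → 0 < S →
      (∀ e' : Sym2 (Site 2), (e' ∈ E.zdABEdges ∨ e' ∈ (shiftData E w).zdABEdges) → 2 * S ≤ dist (medialPoint E.δ e') z) →
      (bondPercolation (zdGraph 2) half).real (ufrsStrands E w z 3 s S) ≤ CT * (s / S) ^ (1 + α))
    (hq : q ∈ D.carrier) (hqd : infDist q D.carrierᶜ ≤ 2 * η) (hη : 0 < η) (hU : η ≤ U) (hα : 0 < α)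
    (hsep : 64 * η ≤ U → ∀ e' : Sym2 (Site 2), (e' ∈ E.zdABEdges ∨ e' ∈ (shiftData E w).zdABEdges) →
      U - 3 * η ≤ dist (medialPoint E.δ e') q) :
    (bondPercolation (zdGraph 2) half).real {ω : BondConfig (Site 2) | (64 * η ≤ U ∧ 32 * η ≤ d) →
        ω ∈ ufrsStrands E w q 3 (7 * η) (min (d / 2) (U / 4) - 3 * η)} ≤
      max CT 1 * (32 * η / min (max d (32 * η)) (U / 16)) ^ (1 + α) := by
  have hD₂ : 0 < min (max d (32 * η)) (U / 16) := lt_min (lt_max_of_lt_right (by linarith)) (by linarith)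
  refine real_imp_le_W3M (fun ⟨hU64, hd32⟩ => ?_) (fun hng => ?_)
  · have hS : 0 < min (d / 2) (U / 4) - 3 * η := by
      have : 16 * η ≤ min (d / 2) (U / 4) := le_min (by linarith) (by linarith)
      linarith
    have hmin : min (d / 2) (U / 4) ≤ U / 4 := min_le_right _ _
    refine le_trans (hT q (7 * η) _ hq (by linarith) (by linarith) hS fun e' he' => ?_) ?_
    · have := hsep hU64 e' he'; linarith
    refine le_trans (mul_le_mul_of_nonneg_right (le_max_left CT 1) (Real.rpow_nonneg (by positivity) _)) ?_
    refine mul_le_mul_of_nonneg_left (rpow_ratio_le_W3M (by positivity) hS hD₂ ?_ (by linarith)) (by positivity)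
    -- `7η · D₂ ≤ 32η · S`
    have hmax : max d (32 * η) = d := max_eq_left hd32
    rw [hmax]
    rcases le_total (d / 2) (U / 4) with h | h
    · rw [min_eq_left h]
      have h1 : min d (U / 16) ≤ d := min_le_left _ _
      nlinarith
    · rw [min_eq_right h]
      have h1 : min d (U / 16) ≤ U / 16 := min_le_right _ _
      nlinarith
  · refine one_le_mul_of_one_le_of_one_le (le_max_right _ _) (one_le_rpow_ratio_W3M hD₂ ?_ (by linarith))
    -- `D₂ ≤ 32 η`
    rcases not_and_or.1 hng with h | h
    · have := min_le_right (max d (32 * η)) (U / 16); linarith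
    · rw [max_eq_right (by linarith : d ≤ 32 * η)]
      exact min_le_left _ _

/-- **Flat factor, outer scale.** The guarded event "three strand-crossings of
`A(q; 2d + 3η, U/4 - 3η)`" (guard `64η ≤ U ∧ d ≤ U/16`) has probability at most
`C_T' (16 D₂ / U)^{1+α}`. -/
theorem flat₂_le_W3M {D : DobrushinDomain} {E : DiscreteDobrushin} {w : Site 2} {η U d CT α : ℝ} {q : ℂ}
    (hT : ∀ (z : ℂ) (s S : ℝ), z ∈ D.carrier → infDist z D.carrierᶜ ≤ s → η ≤ s → 0 < S →
      (∀ e' : Sym2 (Site 2), (e' ∈ E.zdABEdges ∨ e' ∈ (shiftData E w).zdABEdges) → 2 * S ≤ dist (medialPoint E.δ e') z) →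
      (bondPercolation (zdGraph 2) half).real (ufrsStrands E w z 3 s S) ≤ CT * (s / S) ^ (1 + α))
    (hq : q ∈ D.carrier) (hqd : infDist q D.carrierᶜ ≤ 2 * η) (hη : 0 < η) (hU : η ≤ U) (hd : 0 < d) (hα : 0 < α)
    (hsep : 64 * η ≤ U → ∀ e' : Sym2 (Site 2), (e' ∈ E.zdABEdges ∨ e' ∈ (shiftData E w).zdABEdges) →
      U - 3 * η ≤ dist (medialPoint E.δ e') q) :
    (bondPercolation (zdGraph 2) half).real {ω : BondConfig (Site 2) | (64 * η ≤ U ∧ d ≤ U / 16) →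
        ω ∈ ufrsStrands E w q 3 (2 * d + 3 * η) (U / 4 - 3 * η)} ≤
      max CT 1 * (16 * min (max d (32 * η)) (U / 16) / U) ^ (1 + α) := by
  have hD₂ : 0 < min (max d (32 * η)) (U / 16) := lt_min (lt_max_of_lt_right (by linarith)) (by linarith)
  have hUpos : 0 < U := by linarith
  refine real_imp_le_W3M (fun ⟨hU64, hd16⟩ => ?_) (fun hng => ?_)
  · have hS : 0 < U / 4 - 3 * η := by linarith
    refine le_trans (hT q (2 * d + 3 * η) _ hq (by linarith) (by linarith) hS fun e' he' => ?_) ?_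
    · have := hsep hU64 e' he'; linarith
    refine le_trans (mul_le_mul_of_nonneg_right (le_max_left CT 1) (Real.rpow_nonneg (by positivity) _)) ?_
    refine mul_le_mul_of_nonneg_left (rpow_ratio_le_W3M (by positivity) hS hUpos ?_ (by linarith)) (by positivity)
    -- `(2d + 3η) · U ≤ 16 D₂ · (U/4 - 3η)`
    rcases le_total (512 * η) U with h | h
    · have hle : max d (32 * η) ≤ U / 16 := max_le hd16 (by linarith)
      rw [min_eq_left hle]
      have h1 : d ≤ max d (32 * η) := le_max_left _ _
      have h2 : 32 * η ≤ max d (32 * η) := le_max_right _ _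
      nlinarith
    · have hle : U / 16 ≤ max d (32 * η) := le_trans (by linarith) (le_max_right _ _)
      rw [min_eq_right hle]
      nlinarith
  · refine one_le_mul_of_one_le_of_one_le (le_max_right _ _) (one_le_rpow_ratio_W3M hUpos ?_ (by linarith))
    -- `U ≤ 16 D₂`
    have hle : U / 16 ≤ max d (32 * η) := by
      rcases not_and_or.1 hng with h | h
      · exact le_trans (by linarith) (le_max_right _ _)
      · exact le_trans (by linarith) (le_max_left _ _)
    rw [min_eq_right hle]
    linarith

/-- **Junction factor, inner scale.** The guarded event "two strand-crossings of
`A(m; 6U, d/2 - 2U)`" (guard `64U ≤ d`) has probability at most `C_J' (64 U / D₁)^β`,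
`D₁ = max d (64 U)`, `C_J' = max C_J 1`, given the junction two-strand decay at `m` (`hJ`). -/
theorem junc₁_le_W3M {E : DiscreteDobrushin} {w : Site 2} {η U d CJ β : ℝ} {m : ℂ}
    (hJ : ∀ s S : ℝ, η ≤ s → 0 < S → (bondPercolation (zdGraph 2) half).real (ufrsStrands E w m 2 s S) ≤ CJ * (s / S) ^ β)
    (hη : 0 < η) (hU : η ≤ U) (hβ : 0 < β) :
    (bondPercolation (zdGraph 2) half).real {ω : BondConfig (Site 2) | 64 * U ≤ d → ω ∈ ufrsStrands E w m 2 (6 * U) (d / 2 - 2 * U)} ≤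
      max CJ 1 * (64 * U / max d (64 * U)) ^ β := by
  have hUpos : 0 < U := by linarith
  have hD₁ : 0 < max d (64 * U) := lt_max_of_lt_right (by linarith)
  refine real_imp_le_W3M (fun hg => ?_) (fun hng => ?_)
  · have hS : 0 < d / 2 - 2 * U := by linarith
    refine le_trans (hJ (6 * U) _ (by linarith) hS) ?_
    refine le_trans (mul_le_mul_of_nonneg_right (le_max_left CJ 1) (Real.rpow_nonneg (by positivity) _)) ?_
    refine mul_le_mul_of_nonneg_left (rpow_ratio_le_W3M (by positivity) hS hD₁ ?_ hβ.le) (by positivity)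
    rw [max_eq_left hg]
    nlinarith
  · refine one_le_mul_of_one_le_of_one_le (le_max_right _ _) (one_le_rpow_ratio_W3M hD₁ ?_ hβ.le)
    rw [max_eq_right (by linarith : d ≤ 64 * U)]

/-- **Junction factor, middle scale.** The guarded event "two strand-crossings of
`A(m; max(2d, 4U) + 2U, R' - 2U)`" (guard `64U ≤ R'`) has probability at most
`C_J' (64 D₁ / R₁)^β`, `R₁ = max R' (64 U)`. -/
theorem junc₂_le_W3M {E : DiscreteDobrushin} {w : Site 2} {η U d R' CJ β : ℝ} {m : ℂ}
    (hJ : ∀ s S : ℝ, η ≤ s → 0 < S → (bondPercolation (zdGraph 2) half).real (ufrsStrands E w m 2 s S) ≤ CJ * (s / S) ^ β)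
    (hη : 0 < η) (hU : η ≤ U) (hd : 0 < d) (hβ : 0 < β) :
    (bondPercolation (zdGraph 2) half).real {ω : BondConfig (Site 2) | 64 * U ≤ R' →
        ω ∈ ufrsStrands E w m 2 (max (2 * d) (4 * U) + 2 * U) (R' - 2 * U)} ≤
      max CJ 1 * (64 * max d (64 * U) / max R' (64 * U)) ^ β := by
  have hUpos : 0 < U := by linarith
  have hD₁ : 0 < max d (64 * U) := lt_max_of_lt_right (by linarith)
  have hR₁ : 0 < max R' (64 * U) := lt_max_of_lt_right (by linarith)
  refine real_imp_le_W3M (fun hg => ?_) (fun hng => ?_)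
  · have hS : 0 < R' - 2 * U := by linarith
    refine le_trans (hJ _ _ (le_trans (by linarith : η ≤ 4 * U) ((le_max_right _ _).trans (by linarith))) hS) ?_
    refine le_trans (mul_le_mul_of_nonneg_right (le_max_left CJ 1) (Real.rpow_nonneg (by positivity) _)) ?_
    refine mul_le_mul_of_nonneg_left (rpow_ratio_le_W3M (by positivity) hS hR₁ ?_ hβ.le) (by positivity)
    rw [max_eq_left hg]
    have h1 : max (2 * d) (4 * U) ≤ 2 * max d (64 * U) :=
      max_le (by linarith [le_max_left d (64 * U)]) (by linarith [le_max_right d (64 * U)])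
    have h2 : 64 * U ≤ max d (64 * U) := le_max_right _ _
    nlinarith
  · refine one_le_mul_of_one_le_of_one_le (le_max_right _ _) (one_le_rpow_ratio_W3M hR₁ ?_ hβ.le)
    rw [max_eq_right (by linarith : R' ≤ 64 * U)]
    linarith [le_max_right d (64 * U)]

/-- **Junction factor, outer scale.** The guarded event "two strand-crossings of
`A(m; 8R' + 2U, ρ/4 - 2U)`" (guard `64U ≤ ρ`) has probability at most `C_J' (64 R₁ / ρ₁)^β`,
`ρ₁ = max ρ (64 U)`. -/
theorem junc₃_le_W3M {E : DiscreteDobrushin} {w : Site 2} {η U R' ρ CJ β : ℝ} {m : ℂ}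
    (hJ : ∀ s S : ℝ, η ≤ s → 0 < S → (bondPercolation (zdGraph 2) half).real (ufrsStrands E w m 2 s S) ≤ CJ * (s / S) ^ β)
    (hη : 0 < η) (hU : η ≤ U) (hR' : 0 < R') (hβ : 0 < β) :
    (bondPercolation (zdGraph 2) half).real {ω : BondConfig (Site 2) | 64 * U ≤ ρ →
        ω ∈ ufrsStrands E w m 2 (8 * R' + 2 * U) (ρ / 4 - 2 * U)} ≤
      max CJ 1 * (64 * max R' (64 * U) / max ρ (64 * U)) ^ β := by
  have hUpos : 0 < U := by linarith
  have hR₁ : 0 < max R' (64 * U) := lt_max_of_lt_right (by linarith)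
  have hρ₁ : 0 < max ρ (64 * U) := lt_max_of_lt_right (by linarith)
  refine real_imp_le_W3M (fun hg => ?_) (fun hng => ?_)
  · have hS : 0 < ρ / 4 - 2 * U := by linarith
    refine le_trans (hJ _ _ (by linarith) hS) ?_
    refine le_trans (mul_le_mul_of_nonneg_right (le_max_left CJ 1) (Real.rpow_nonneg (by positivity) _)) ?_
    refine mul_le_mul_of_nonneg_left (rpow_ratio_le_W3M (by positivity) hS hρ₁ ?_ hβ.le) (by positivity)
    rw [max_eq_left hg]
    have h1 : R' ≤ max R' (64 * U) := le_max_left _ _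
    have h2 : 64 * U ≤ max R' (64 * U) := le_max_right _ _
    nlinarith
  · refine one_le_mul_of_one_le_of_one_le (le_max_right _ _) (one_le_rpow_ratio_W3M hρ₁ ?_ hβ.le)
    rw [max_eq_right (by linarith : ρ ≤ 64 * U)]
    linarith [le_max_right R' (64 * U)]

end

end Summit.CriticalPhenomena.CardyFormulaZ2.Cruxes.EdgePrecompact.QkzStripBoundaryArm
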